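import Literature.Analysis.FluidPDE.LocalTypeILiouville
import Literature.Analysis.FluidPDE.SuitableWeakCongr
import HarnessLib

/-!
# Albritton–Barker's quantities and singular points under a.e. modification; representatives
# with the POINTWISE Type-I bounds

Analysis/FluidPDE proofs-layer file (theorems only, no definitions, no named facts) over
`LocalTypeI.lean` / `LocalTypeILiouville.lean` (D. Albritton, T. Barker, J. Math. Fluid Mech. 21 (2019) = arXiv:1811.00502, §1:
`cknAEss = A`, `abScaledSum = A + C + D + E`, `typeIBound ω = 𝐈(ω)`, `IsBackwardSingularPoint`),
`SuitableWeakCongr.lean` (a.e.-invariance of `IsSuitableWeakSolutionOn`, `HasWeakSpatialGradientOn`)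
and `SelfSimilar.lean` (`HasTypeITimeDecay`, `HasTypeIDecay`: KNSS 2009 (1.4)/(1.6), stated
POINTWISE for all `t < 0`, `x`).

The Type-I "profile classes" used by the Navier–Stokes summit's Type-I routes conjoin a.e.-level
notions (suitable weak solution, weak gradient, `𝐈 < ∞`, essential-sup singularity) with the
pointwise bounds (1.4)/(1.6). Compactness arguments (A–B Lemma 2.2 / Prop. 2.3) deliver limits only
almost everywhere. This file supplies the (tacit, CKN 1982 §2) freedom of representatives:

* `cknAEss_congr_ae`, `cknC_congr_ae`, `abScaledSum_congr_ae`, `typeIBound_congr_ae` — A–B's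
  `A`, `C`, `A + C + D + E` and `𝐈(ω)` do not change when `u` is modified on a null subset of the
  ball / of `ω` (Fubini for the `esssup_t` in `A`);
* `IsBackwardSingularPoint.congr_ae` — neither do backward singular points;
* `exists_repr_hasTypeITimeDecay`, `exists_repr_hasTypeIDecay` — a field obeying the rate (resp.
  the space–time bound) ALMOST EVERYWHERE on the slab `(-∞,0) × ℝ³` has an a.e.-equal modification
  obeying it EVERYWHERE;
* `exists_rate_profile_repr`, `exists_apex_profile_repr` — hence an a.e.-Type-I suitable weak
  solution on the slab with weak gradient, `𝐈(ℝ³ × ℝ₋) < ∞` and a singular origin has a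
  representative in the pointwise rate (resp. apex) class with the same pressure and gradient.

## References

* D. Albritton, T. Barker, J. Math. Fluid Mech. 21 (2019), no. 3 = arXiv:1811.00502, §1.
  [AlbrittonBarker2019]
* L. Caffarelli, R. Kohn, L. Nirenberg, CPAM 35 (1982), §2 (classes of suitable weak solutions are
  `L^p` classes). [CaffarelliKohnNirenberg1982]
* G. Koch, N. Nadirashvili, G. Seregin, V. Šverák, Acta Math. 203 (2009), (1.4), (1.6). [KNSS2009]
-/

noncomputable section

open MeasureTheory TopologicalSpace Set Function Filter Topology Metric
open scoped InnerProductSpace RealInnerProductSpace ENNReal NNReal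

namespace Literature.Analysis.FluidPDE

section CongrAE

/-- Local notation for physical space `ℝ³ = EuclideanSpace ℝ (Fin 3)`. -/
local notation "ℝ³" => EuclideanSpace ℝ (Fin 3)

variable {u u' : ℝ → ℝ³ → ℝ³} {p : ℝ → ℝ³ → ℝ} {G : ℝ → ℝ³ → ℝ³ →L[ℝ] ℝ³} {r : ℝ} {z : ℝ × ℝ³}

/-- The measure restricted to a parabolic ball is the product of the restricted measures.
[folklore] -/
theorem volume_restrict_parabolicCylinder_eq_prod' (r : ℝ) (z : ℝ × ℝ³) :
    (volume : Measure (ℝ × ℝ³)).restrict (parabolicCylinder r z) =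
      (volume.restrict (Ioo (z.1 - r ^ 2) z.1)).prod (volume.restrict (ball z.2 r)) := by
  rw [Measure.prod_restrict, ← Measure.volume_eq_prod]
  rfl

/-- A property holding a.e. on a parabolic ball holds, for a.e. time, a.e. on the spatial ball
(Fubini). [folklore] -/
theorem ae_slice_of_ae_parabolicCylinder {P : ℝ × ℝ³ → Prop}
    (h : ∀ᵐ w ∂(volume.restrict (parabolicCylinder r z)), P w) :
    ∀ᵐ t ∂(volume.restrict (Ioo (z.1 - r ^ 2) z.1)), ∀ᵐ x ∂(volume.restrict (ball z.2 r)), P (t, x) := by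
  rw [volume_restrict_parabolicCylinder_eq_prod'] at h
  exact Measure.ae_ae_of_ae_prod h

/-- **`A(Q(z,r))` is invariant under a.e. modification of the field on the ball**
(Albritton–Barker's `esssup_t r⁻¹ ∫_{B_r} |u|²`; Fubini + `esssup` ignores null sets of times).
[cite: AlbrittonBarker2019, §1] -/
theorem cknAEss_congr_ae
    (h : ∀ᵐ w ∂(volume.restrict (parabolicCylinder r z)), uncurry u w = uncurry u' w) :
    cknAEss r z u = cknAEss r z u' := by
  unfold cknAEss
  refine essSup_congr_ae ?_
  filter_upwards [ae_slice_of_ae_parabolicCylinder h] with t ht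
  show (ENNReal.ofReal r)⁻¹ * ∫⁻ x in ball z.2 r, ‖u t x‖ₑ ^ 2 =
    (ENNReal.ofReal r)⁻¹ * ∫⁻ x in ball z.2 r, ‖u' t x‖ₑ ^ 2
  congr 1
  refine lintegral_congr_ae ?_
  filter_upwards [ht] with x hx
  have hx' : u t x = u' t x := hx
  rw [hx']

/-- `C(Q(z,r))` is invariant under a.e. modification of the field on the ball. [folklore] -/
theorem cknC_congr_ae
    (h : ∀ᵐ w ∂(volume.restrict (parabolicCylinder r z)), uncurry u w = uncurry u' w) :
    cknC r z u = cknC r z u' := by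
  unfold cknC
  congr 1
  refine lintegral_congr_ae ?_
  filter_upwards [h] with w hw
  have hw' : u w.1 w.2 = u' w.1 w.2 := hw
  simp only [hw']

/-- `(A + C + D + E)(Q(z,r))` is invariant under a.e. modification of the field on the ball
(`D` sees only `p`, `E` only `G`). [cite: AlbrittonBarker2019, §1] -/
theorem abScaledSum_congr_ae
    (h : ∀ᵐ w ∂(volume.restrict (parabolicCylinder r z)), uncurry u w = uncurry u' w) :
    abScaledSum r z u p G = abScaledSum r z u' p G := by
  unfold abScaledSum
  rw [cknAEss_congr_ae h, cknC_congr_ae h]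

/-- **`𝐈(ω)` is invariant under a.e. modification of the field on `ω`** (every admissible ball
lies in `ω`). [cite: AlbrittonBarker2019, §1] -/
theorem typeIBound_congr_ae {ω : Set (ℝ × ℝ³)}
    (h : ∀ᵐ w ∂(volume.restrict ω), uncurry u w = uncurry u' w) :
    typeIBound ω u p G = typeIBound ω u' p G := by
  unfold typeIBound
  refine iSup_congr fun r => iSup_congr fun _ => iSup_congr fun z => iSup_congr fun hz => ?_
  exact abScaledSum_congr_ae (ae_restrict_of_ae_restrict_of_subset hz h)

/-- **Backward singular points are invariant under a.e. modification** of the field on any set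
containing the backward balls at the point (the `L^∞` norms are essential). [cite: AlbrittonBarker2019, §1] -/
theorem IsBackwardSingularPoint.congr_ae {S : Set (ℝ × ℝ³)}
    (hS : ∀ r, 0 < r → parabolicCylinder r z ⊆ S)
    (h : ∀ᵐ w ∂(volume.restrict S), uncurry u w = uncurry u' w) (hs : IsBackwardSingularPoint u z) :
    IsBackwardSingularPoint u' z := by
  intro r hr
  have e : eLpNorm (uncurry u') ∞ (volume.restrict (parabolicCylinder r z)) =
      eLpNorm (uncurry u) ∞ (volume.restrict (parabolicCylinder r z)) :=
    (eLpNorm_congr_ae (ae_restrict_of_ae_restrict_of_subset (hS r hr) h)).symm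
  rw [e]
  exact hs r hr

/-! ### Representatives with the pointwise Type-I bounds -/

/-- **A field with the Type-I RATE almost everywhere on the slab has an a.e.-equal modification
with the rate EVERYWHERE** (`t < 0`): set `u' = u` where the bound holds and `u' = 0` elsewhere
(`0 ≤ C`). [cite: KNSS2009, (1.4)] -/
theorem exists_repr_hasTypeITimeDecay {C : ℝ} (hC : 0 ≤ C)
    (h : ∀ᵐ w ∂(volume.restrict (Iio (0 : ℝ) ×ˢ (univ : Set ℝ³))),
      ‖u w.1 w.2‖ ≤ C / Real.sqrt (-w.1)) :
    ∃ u' : ℝ → ℝ³ → ℝ³,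
      (∀ᵐ w ∂(volume.restrict (Iio (0 : ℝ) ×ˢ (univ : Set ℝ³))), uncurry u w = uncurry u' w) ∧
        HasTypeITimeDecay C u' := by
  classical
  refine ⟨fun t x => if ‖u t x‖ ≤ C / Real.sqrt (-t) then u t x else 0, ?_, ?_⟩
  · filter_upwards [h] with w hw
    simp only [uncurry]
    rw [if_pos hw]
  · intro t _ x
    by_cases hb : ‖u t x‖ ≤ C / Real.sqrt (-t)
    · simp only [if_pos hb]
      exact hb
    · simp only [if_neg hb, norm_zero]
      positivity

/-- **A field with the space–time Type-I (apex) bound almost everywhere on the slab has an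
a.e.-equal modification with the bound EVERYWHERE** (`t < 0`). [cite: KNSS2009, (1.6)] -/
theorem exists_repr_hasTypeIDecay {C : ℝ} (hC : 0 ≤ C)
    (h : ∀ᵐ w ∂(volume.restrict (Iio (0 : ℝ) ×ˢ (univ : Set ℝ³))),
      ‖u w.1 w.2‖ ≤ C / (‖w.2‖ + Real.sqrt (-w.1))) :
    ∃ u' : ℝ → ℝ³ → ℝ³,
      (∀ᵐ w ∂(volume.restrict (Iio (0 : ℝ) ×ˢ (univ : Set ℝ³))), uncurry u w = uncurry u' w) ∧
        HasTypeIDecay C u' := by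
  classical
  refine ⟨fun t x => if ‖u t x‖ ≤ C / (‖x‖ + Real.sqrt (-t)) then u t x else 0, ?_, ?_⟩
  · filter_upwards [h] with w hw
    simp only [uncurry]
    rw [if_pos hw]
  · intro t _ x
    by_cases hb : ‖u t x‖ ≤ C / (‖x‖ + Real.sqrt (-t))
    · simp only [if_pos hb]
      exact hb
    · simp only [if_neg hb, norm_zero]
      positivity

/-- **Representatives in the pointwise RATE class.** An a.e.-Type-I-rate suitable weak solution of
Navier–Stokes (`ν = 1`, `f = 0`) on the slab `(-∞,0) × ℝ³` with weak gradient `G`,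
`𝐈(ℝ³ × ℝ₋) < ∞` and a backward-singular origin has an a.e.-equal representative satisfying all
of it with the rate bound POINTWISE (same pressure and gradient): the form in which the summit's
Type-I routes quantify ("rate-Type-I singular slab profile").
[cite: AlbrittonBarker2019, §1] -/
theorem exists_rate_profile_repr {C : ℝ} (hC : 0 ≤ C)
    (hsw : IsSuitableWeakSolutionOn (slab ℝ³ (Iio 0) isOpen_Iio) 1 0 u p)
    (hwg : HasWeakSpatialGradientOn (slab ℝ³ (Iio 0) isOpen_Iio) u G)
    (hI : typeIBound (Iio (0 : ℝ) ×ˢ (univ : Set ℝ³)) u p G < ∞)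
    (hsing : IsBackwardSingularPoint u 0)
    (hrate : ∀ᵐ w ∂(volume.restrict (Iio (0 : ℝ) ×ˢ (univ : Set ℝ³))),
      ‖u w.1 w.2‖ ≤ C / Real.sqrt (-w.1)) :
    ∃ u' : ℝ → ℝ³ → ℝ³,
      (∀ᵐ w ∂(volume.restrict (Iio (0 : ℝ) ×ˢ (univ : Set ℝ³))), uncurry u w = uncurry u' w) ∧
      IsSuitableWeakSolutionOn (slab ℝ³ (Iio 0) isOpen_Iio) 1 0 u' p ∧
      HasWeakSpatialGradientOn (slab ℝ³ (Iio 0) isOpen_Iio) u' G ∧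
      typeIBound (Iio (0 : ℝ) ×ˢ (univ : Set ℝ³)) u' p G < ∞ ∧
      HasTypeITimeDecay C u' ∧ IsBackwardSingularPoint u' 0 := by
  obtain ⟨u', hae, hdec⟩ := exists_repr_hasTypeITimeDecay hC hrate
  have hae' : ∀ᵐ w ∂(volume.restrict ((slab ℝ³ (Iio 0) isOpen_Iio : Opens (ℝ × ℝ³)) : Set (ℝ × ℝ³))),
      uncurry u w = uncurry u' w := by
    rw [coe_slab]
    exact hae
  refine ⟨u', hae, hsw.congr_ae hae' (ae_of_all _ fun _ => rfl), hwg.congr_ae hae', ?_, hdec,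
    hsing.congr_ae (fun r _ => parabolicCylinder_origin_subset_slab r) hae⟩
  rwa [← typeIBound_congr_ae hae]

/-- **Representatives in the pointwise APEX class** (space–time bound (1.6) pointwise), same
statement with `C/(‖x‖ + √(−t))`. [cite: AlbrittonBarker2019, §1] -/
theorem exists_apex_profile_repr {C : ℝ} (hC : 0 ≤ C)
    (hsw : IsSuitableWeakSolutionOn (slab ℝ³ (Iio 0) isOpen_Iio) 1 0 u p)
    (hwg : HasWeakSpatialGradientOn (slab ℝ³ (Iio 0) isOpen_Iio) u G)
    (hI : typeIBound (Iio (0 : ℝ) ×ˢ (univ : Set ℝ³)) u p G < ∞)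
    (hsing : IsBackwardSingularPoint u 0)
    (hapex : ∀ᵐ w ∂(volume.restrict (Iio (0 : ℝ) ×ˢ (univ : Set ℝ³))),
      ‖u w.1 w.2‖ ≤ C / (‖w.2‖ + Real.sqrt (-w.1))) :
    ∃ u' : ℝ → ℝ³ → ℝ³,
      (∀ᵐ w ∂(volume.restrict (Iio (0 : ℝ) ×ˢ (univ : Set ℝ³))), uncurry u w = uncurry u' w) ∧
      IsSuitableWeakSolutionOn (slab ℝ³ (Iio 0) isOpen_Iio) 1 0 u' p ∧
      HasWeakSpatialGradientOn (slab ℝ³ (Iio 0) isOpen_Iio) u' G ∧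
      typeIBound (Iio (0 : ℝ) ×ˢ (univ : Set ℝ³)) u' p G < ∞ ∧
      HasTypeIDecay C u' ∧ IsBackwardSingularPoint u' 0 := by
  obtain ⟨u', hae, hdec⟩ := exists_repr_hasTypeIDecay hC hapex
  have hae' : ∀ᵐ w ∂(volume.restrict ((slab ℝ³ (Iio 0) isOpen_Iio : Opens (ℝ × ℝ³)) : Set (ℝ × ℝ³))),
      uncurry u w = uncurry u' w := by
    rw [coe_slab]
    exact hae
  refine ⟨u', hae, hsw.congr_ae hae' (ae_of_all _ fun _ => rfl), hwg.congr_ae hae', ?_, hdec,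
    hsing.congr_ae (fun r _ => parabolicCylinder_origin_subset_slab r) hae⟩
  rwa [← typeIBound_congr_ae hae]

end CongrAE

end Literature.Analysis.FluidPDE
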